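import Summits.CriticalPhenomena.PercolationContinuityZ3.Theorems.PercAnnulusCrossingIICPairFormula
import Summits.CriticalPhenomena.PercolationContinuityZ3.Theorems.PercAnnulusCrossingIICTwoPointSandwich
import HarnessLib

/-!
# The pair-connectivity formula of Kesten's IIC: symmetric and conditional forms (lane RSW3, p1 gen 21)

builds on p205010 (kernel theorem, internal audit signed; external expert review pending) — USED through `θ(p_c) = 0`
(exact re-rooting, inside `…IICPairFormula`).

RSW3 lane (LANE 3 `prim-rsw3`), seat `prim-rsw3-p1` (gen 21).  Helper file (`--supports stmt-CriticalPhenomena-4575`);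
no definitions, no sorries.  Memo `run/shared/lean/prim/rsw3/P1-QM.md` §34.

Two re-packagings of `exists_iicMeasure_real_pair_two_sided_criticalProbI` (`ν(x, y ∈ C(0)) ≍ π(min(‖x‖,‖y‖))·π(‖x − y‖)`):

* **`exists_iicMeasure_real_pair_two_sided_longest_criticalProbI`** — the symmetric form **`ν(x, y ∈ C(0))·π(d₃) ≍ π(‖x‖)·π(‖y‖)·π(‖x − y‖)`**,
  `d₃ = max(‖x‖, ‖y‖, ‖x − y‖)` the longest side of the triangle `{0, x, y}` (so `ν ≍ π(d₁)π(d₂)` for the two shortest sides);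
* **`exists_iicMeasure_real_pair_two_sided_nearer_criticalProbI`** — GIVEN THAT THE IIC CONTAINS `x`, IT CONTAINS ANY FARTHER SITE `y` WITH
  PROBABILITY `≍ π(‖y − x‖)`: **`c·π(‖y − x‖)·ν(0 ↔ x) ≤ ν(x, y ∈ C(0)) ≤ C·π(‖y − x‖)·ν(0 ↔ x)`** for `‖x‖ ≤ ‖y‖` — from each of its sites the
  IIC looks like an IIC at ALL larger distances (two-point level), not only below the distance to the root as in gen 20 (6);
* **`exists_iicMeasure_real_pair_correlation_two_sided_criticalProbI`** — THE PAIR CORRELATION FUNCTION OF THE IIC: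
  **`ν(x, y ∈ C(0))·π(max(‖x‖,‖y‖)) ≍ π(‖x − y‖)·ν(0 ↔ x)·ν(0 ↔ y)`** (strong clustering at short range);
* **`exists_iicMeasure_real_pair_ge_mul_criticalProbI`** — THE SITES OF THE IIC ARE QUASI-POSITIVELY CORRELATED:
  **`ν(x, y ∈ C(0)) ≥ c·ν(0 ↔ x)·ν(0 ↔ y)`** (not automatic for a conditional limit measure).
All at `p_c(ℤ^d)`, `d ≥ 2`, under (A2)□(s,L) + `CU⁺_l` + UAD, for IIC probability measures `ν`, constants uniform in `ν`.
References: H. Kesten, Probab. Theory Relat. Fields 73 (1986) Thm. (8); A. Járai, Ann. Probab. 31 (2003) §3;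
D. Basu, A. Sapozhnikov, ECP 22 (2017) Thm. 1.1, Remark 2.1.
-/

noncomputable section

namespace Summit.CriticalPhenomena.PercolationContinuityZ3.Theorems.Crossing

open MeasureTheory Filter Topology Literature.Probability.Percolation Literature.Probability.LatticeModels
open Literature.Probability.Percolation.DCT16
open Summit.CriticalPhenomena.PercolationContinuityZ3.Theorems.SurfaceTension

variable {d : ℕ}

/-- **THE SYMMETRIC FORM: `ν(x, y ∈ C(0))·π(longest side) ≍ π(‖x‖)·π(‖y‖)·π(‖x − y‖)`** (hypotheses of
`exists_iicMeasure_real_pair_two_sided_criticalProbI`): there are `n₀ ≥ 1` and `0 < c, C` such that for every IIC probability measure `ν` and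
all `x, y` with `‖x‖_∞, ‖y‖_∞, ‖x − y‖_∞ ≥ n₀`, writing `d₃ = max(‖x‖, ‖y‖, ‖x − y‖)` for the longest side of the triangle `{0, x, y}`:
**`c·π(‖x‖)π(‖y‖)π(‖x − y‖) ≤ ν({0 ↔ x} ∩ {0 ↔ y})·π(d₃) ≤ C·π(‖x‖)π(‖y‖)π(‖x − y‖)`** (the product of the one-arm probabilities of all
three sides, divided by that of the longest: `d₃ ≤ d₁ + d₂ ≤ 2d₂` and `π(d₂) ≍ π(d₃)` by the ratio bound).
[cite: Kesten1986, Thm. (8)] [cite: BasuSapozhnikov2017ECP, Thm. 1.1 and Remark 2.1] -/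
theorem exists_iicMeasure_real_pair_two_sided_longest_criticalProbI (hd : 2 ≤ d) {s L : ℕ} (hs : 2 ≤ s) (hsL : s ≤ L)
    {ϰ : ℝ} (hϰ : 0 < ϰ) (hA2 : SetToSetQuasiMultAspectAt d (criticalProbI d) s L ϰ) {l : ℕ} (hl : 2 ≤ l) {cU : ℝ} (hcU : 0 < cU)
    (hCU : ∀ a : ℕ, 1 ≤ a → ∀ E : Set (BondConfig (Site d)), IsUpperSet E → MeasurableSet E →
      cU * (bondPercolation (zdGraph d) (criticalProbI d)).real E ≤ (bondPercolation (zdGraph d) (criticalProbI d)).real (E ∩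
        {ω : BondConfig (Site d) | ∀ t ∈ innerBoundary (zdGraph d) (box d a), ∀ s ∈ innerBoundary (zdGraph d) (box d (l * a)),
          ∀ t' ∈ innerBoundary (zdGraph d) (box d a), ∀ s' ∈ innerBoundary (zdGraph d) (box d (l * a)),
          ω ∈ openConnIn (↑((box d (l * a) \ box d a) ∪ innerBoundary (zdGraph d) (box d a)) : Set (Site d)) t s →
          ω ∈ openConnIn (↑((box d (l * a) \ box d a) ∪ innerBoundary (zdGraph d) (box d a)) : Set (Site d)) t' s' →
          ω ∈ openConnIn (↑((box d (l * a) \ box d a) ∪ innerBoundary (zdGraph d) (box d a)) : Set (Site d)) s s'}))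
    (hUAD : ∀ ε : ℝ, 0 < ε → ∃ K₀ : ℕ, ∀ m : ℕ, 1 ≤ m → ∀ N : ℕ, K₀ * m ≤ N →
      (bondPercolation (zdGraph d) (criticalProbI d)).real (boxCrossing d m N) ≤ ε) :
    ∃ (n₀ : ℕ) (c C : ℝ), 1 ≤ n₀ ∧ 0 < c ∧ 0 < C ∧ ∀ (ν : Measure (BondConfig (Site d))) [IsProbabilityMeasure ν],
      (∀ (F : Finset (Sym2 (Site d))) (E : Set (BondConfig (Site d))), MeasurableSet E → DeterminedBy E ↑F →
        Tendsto (fun n : ℕ => (bondPercolation (zdGraph d) (criticalProbI d)).real (E ∩ siteToBoundary d n) /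
          oneArmProb d (criticalProbI d) n) atTop (𝓝 (ν.real E))) →
      ∀ x y : Site d, n₀ ≤ Site.supNorm x → n₀ ≤ Site.supNorm y → n₀ ≤ Site.supNorm (x - y) →
        c * oneArmProb d (criticalProbI d) (Site.supNorm x) * oneArmProb d (criticalProbI d) (Site.supNorm y) *
              oneArmProb d (criticalProbI d) (Site.supNorm (x - y)) ≤
            ν.real ((openConn (0 : Site d) x : Set (BondConfig (Site d))) ∩ openConn (0 : Site d) y) *
              oneArmProb d (criticalProbI d) (max (max (Site.supNorm x) (Site.supNorm y)) (Site.supNorm (x - y))) ∧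
          ν.real ((openConn (0 : Site d) x : Set (BondConfig (Site d))) ∩ openConn (0 : Site d) y) *
              oneArmProb d (criticalProbI d) (max (max (Site.supNorm x) (Site.supNorm y)) (Site.supNorm (x - y))) ≤
            C * oneArmProb d (criticalProbI d) (Site.supNorm x) * oneArmProb d (criticalProbI d) (Site.supNorm y) *
              oneArmProb d (criticalProbI d) (Site.supNorm (x - y)) := by
  have hd1 : 1 ≤ d := le_trans (by norm_num) hd
  have hp : 0 < ((criticalProbI d : unitInterval) : ℝ) := by
    rw [coe_criticalProbI]; exact criticalProb_zd_pos d hd1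
  have hπ : ∀ m : ℕ, 0 < oneArmProb d (criticalProbI d) m := fun m => oneArmProb_pos hd1 _ hp m
  obtain ⟨n₀, c, C, hn₀, hc, hC, hA⟩ := exists_iicMeasure_real_pair_two_sided_criticalProbI hd hs hsL hϰ hA2 hl hcU hCU hUAD
  obtain ⟨B, hB, hR⟩ := Rsw3.exists_oneArmProb_ratio_of_setToSetQuasiMultAspectAt hd hs hsL hϰ hA2
  have hB1 : 1 ≤ B := by
    have h := hR 1 1 le_rfl le_rfl (by norm_num)
    have h1 := hπ 1
    by_contra hlt
    have h2 : B * oneArmProb d (criticalProbI d) 1 < 1 * oneArmProb d (criticalProbI d) 1 :=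
      mul_lt_mul_of_pos_right (lt_of_not_ge hlt) h1
    linarith
  refine ⟨n₀, c / B, C, hn₀, by positivity, hC, fun ν _ hν x y hx hy hxy => ?_⟩
  have hcB : c / B ≤ c := div_le_self hc.le hB1
  wlog hab : Site.supNorm x ≤ Site.supNorm y generalizing x y
  · have h := this y x hy hx (by rwa [Site.supNorm_sub_comm]) (le_of_not_ge hab)
    rw [max_comm (Site.supNorm y) (Site.supNorm x), Site.supNorm_sub_comm, Set.inter_comm] at h
    have e1 : c / B * oneArmProb d (criticalProbI d) (Site.supNorm y) * oneArmProb d (criticalProbI d) (Site.supNorm x) =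
        c / B * oneArmProb d (criticalProbI d) (Site.supNorm x) * oneArmProb d (criticalProbI d) (Site.supNorm y) := by ring
    have e2 : C * oneArmProb d (criticalProbI d) (Site.supNorm y) * oneArmProb d (criticalProbI d) (Site.supNorm x) =
        C * oneArmProb d (criticalProbI d) (Site.supNorm x) * oneArmProb d (criticalProbI d) (Site.supNorm y) := by ring
    rw [e1, e2] at h
    exact h
  have h := hA ν hν x y hx hy hxy
  rw [min_eq_left hab] at h
  rw [max_eq_right hab]
  have hπa := hπ (Site.supNorm x)
  have hπb := hπ (Site.supNorm y)
  have hπe := hπ (Site.supNorm (x - y))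
  have hν0 : 0 ≤ ν.real ((openConn (0 : Site d) x : Set (BondConfig (Site d))) ∩ openConn (0 : Site d) y) := measureReal_nonneg
  have heab : Site.supNorm (x - y) ≤ Site.supNorm x + Site.supNorm y := by
    rw [sub_eq_add_neg, ← Site.supNorm_neg y]; exact Site.supNorm_add_le x (-y)
  rcases le_or_gt (Site.supNorm (x - y)) (Site.supNorm y) with h2 | h2
  · -- longest side `‖y‖`
    rw [max_eq_left h2]
    constructor
    · calc c / B * oneArmProb d (criticalProbI d) (Site.supNorm x) * oneArmProb d (criticalProbI d) (Site.supNorm y) *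
            oneArmProb d (criticalProbI d) (Site.supNorm (x - y))
          = (c / B * oneArmProb d (criticalProbI d) (Site.supNorm x) * oneArmProb d (criticalProbI d) (Site.supNorm (x - y))) *
              oneArmProb d (criticalProbI d) (Site.supNorm y) := by ring
        _ ≤ (c * oneArmProb d (criticalProbI d) (Site.supNorm x) * oneArmProb d (criticalProbI d) (Site.supNorm (x - y))) *
              oneArmProb d (criticalProbI d) (Site.supNorm y) :=
            mul_le_mul_of_nonneg_right (mul_le_mul_of_nonneg_right (mul_le_mul_of_nonneg_right hcB hπa.le) hπe.le) hπb.le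
        _ ≤ _ := mul_le_mul_of_nonneg_right h.1 hπb.le
    · calc ν.real ((openConn (0 : Site d) x : Set (BondConfig (Site d))) ∩ openConn (0 : Site d) y) *
            oneArmProb d (criticalProbI d) (Site.supNorm y)
          ≤ (C * oneArmProb d (criticalProbI d) (Site.supNorm x) * oneArmProb d (criticalProbI d) (Site.supNorm (x - y))) *
              oneArmProb d (criticalProbI d) (Site.supNorm y) := mul_le_mul_of_nonneg_right h.2 hπb.le
        _ = _ := by ring
  · -- longest side `‖x − y‖ ≤ 2‖y‖`
    rw [max_eq_right h2.le]
    have hmono : oneArmProb d (criticalProbI d) (Site.supNorm (x - y)) ≤ oneArmProb d (criticalProbI d) (Site.supNorm y) :=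
      real_siteToBoundary_antitone _ h2.le
    have hratio : oneArmProb d (criticalProbI d) (Site.supNorm y) ≤ B * oneArmProb d (criticalProbI d) (Site.supNorm (x - y)) :=
      hR _ _ (le_trans hn₀ hy) h2.le (by omega)
    constructor
    · calc c / B * oneArmProb d (criticalProbI d) (Site.supNorm x) * oneArmProb d (criticalProbI d) (Site.supNorm y) *
            oneArmProb d (criticalProbI d) (Site.supNorm (x - y))
          ≤ c / B * oneArmProb d (criticalProbI d) (Site.supNorm x) * (B * oneArmProb d (criticalProbI d) (Site.supNorm (x - y))) *
              oneArmProb d (criticalProbI d) (Site.supNorm (x - y)) :=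
            mul_le_mul_of_nonneg_right (mul_le_mul_of_nonneg_left hratio (mul_nonneg (by positivity) hπa.le)) hπe.le
        _ = (c * oneArmProb d (criticalProbI d) (Site.supNorm x) * oneArmProb d (criticalProbI d) (Site.supNorm (x - y))) *
              oneArmProb d (criticalProbI d) (Site.supNorm (x - y)) := by field_simp
        _ ≤ _ := mul_le_mul_of_nonneg_right h.1 hπe.le
    · calc ν.real ((openConn (0 : Site d) x : Set (BondConfig (Site d))) ∩ openConn (0 : Site d) y) *
            oneArmProb d (criticalProbI d) (Site.supNorm (x - y))
          ≤ (C * oneArmProb d (criticalProbI d) (Site.supNorm x) * oneArmProb d (criticalProbI d) (Site.supNorm (x - y))) *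
              oneArmProb d (criticalProbI d) (Site.supNorm y) :=
            mul_le_mul h.2 hmono hπe.le (mul_nonneg (mul_nonneg hC.le hπa.le) hπe.le)
        _ = _ := by ring

/-- **FROM EACH OF ITS SITES KESTEN'S IIC LOOKS LIKE AN IIC AT ALL LARGER DISTANCES** (two-point level; hypotheses of
`exists_iicMeasure_real_pair_two_sided_criticalProbI`): there are `n₀ ≥ 1` and `0 < c, C` such that for every IIC probability measure `ν`,
every site `x` with `‖x‖_∞ ≥ n₀` and every site `y` AT LEAST AS FAR from the root (`‖x‖_∞ ≤ ‖y‖_∞`) with `‖y − x‖_∞ ≥ n₀`: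
**`c·π_{p_c}(‖y − x‖)·ν(0 ↔ x) ≤ ν({0 ↔ x} ∩ {0 ↔ y}) ≤ C·π_{p_c}(‖y − x‖)·ν(0 ↔ x)`** — conditionally on containing `x`, the IIC contains the
farther site `y` with probability `≍ π(‖y − x‖)`, whatever the position of `y` relative to the root (gen 20 (6) had `ρ‖y − x‖ ≤ ‖x‖`).
(Pair formula + the two-point sandwich `ν(0 ↔ x) ≍ π(‖x‖)` of gen 18.) [cite: Kesten1986, Thm. (8)] [cite: BasuSapozhnikov2017ECP, Thm. 1.1] -/
theorem exists_iicMeasure_real_pair_two_sided_nearer_criticalProbI (hd : 2 ≤ d) {s L : ℕ} (hs : 2 ≤ s) (hsL : s ≤ L)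
    {ϰ : ℝ} (hϰ : 0 < ϰ) (hA2 : SetToSetQuasiMultAspectAt d (criticalProbI d) s L ϰ) {l : ℕ} (hl : 2 ≤ l) {cU : ℝ} (hcU : 0 < cU)
    (hCU : ∀ a : ℕ, 1 ≤ a → ∀ E : Set (BondConfig (Site d)), IsUpperSet E → MeasurableSet E →
      cU * (bondPercolation (zdGraph d) (criticalProbI d)).real E ≤ (bondPercolation (zdGraph d) (criticalProbI d)).real (E ∩
        {ω : BondConfig (Site d) | ∀ t ∈ innerBoundary (zdGraph d) (box d a), ∀ s ∈ innerBoundary (zdGraph d) (box d (l * a)),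
          ∀ t' ∈ innerBoundary (zdGraph d) (box d a), ∀ s' ∈ innerBoundary (zdGraph d) (box d (l * a)),
          ω ∈ openConnIn (↑((box d (l * a) \ box d a) ∪ innerBoundary (zdGraph d) (box d a)) : Set (Site d)) t s →
          ω ∈ openConnIn (↑((box d (l * a) \ box d a) ∪ innerBoundary (zdGraph d) (box d a)) : Set (Site d)) t' s' →
          ω ∈ openConnIn (↑((box d (l * a) \ box d a) ∪ innerBoundary (zdGraph d) (box d a)) : Set (Site d)) s s'}))
    (hUAD : ∀ ε : ℝ, 0 < ε → ∃ K₀ : ℕ, ∀ m : ℕ, 1 ≤ m → ∀ N : ℕ, K₀ * m ≤ N →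
      (bondPercolation (zdGraph d) (criticalProbI d)).real (boxCrossing d m N) ≤ ε) :
    ∃ (n₀ : ℕ) (c C : ℝ), 1 ≤ n₀ ∧ 0 < c ∧ 0 < C ∧ ∀ (ν : Measure (BondConfig (Site d))) [IsProbabilityMeasure ν],
      (∀ (F : Finset (Sym2 (Site d))) (E : Set (BondConfig (Site d))), MeasurableSet E → DeterminedBy E ↑F →
        Tendsto (fun n : ℕ => (bondPercolation (zdGraph d) (criticalProbI d)).real (E ∩ siteToBoundary d n) /
          oneArmProb d (criticalProbI d) n) atTop (𝓝 (ν.real E))) →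
      ∀ x y : Site d, n₀ ≤ Site.supNorm x → Site.supNorm x ≤ Site.supNorm y → n₀ ≤ Site.supNorm (y - x) →
        c * oneArmProb d (criticalProbI d) (Site.supNorm (y - x)) * ν.real (openConn (0 : Site d) x) ≤
            ν.real ((openConn (0 : Site d) x : Set (BondConfig (Site d))) ∩ openConn (0 : Site d) y) ∧
          ν.real ((openConn (0 : Site d) x : Set (BondConfig (Site d))) ∩ openConn (0 : Site d) y) ≤
            C * oneArmProb d (criticalProbI d) (Site.supNorm (y - x)) * ν.real (openConn (0 : Site d) x) := by
  have hd1 : 1 ≤ d := le_trans (by norm_num) hd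
  have hp : 0 < ((criticalProbI d : unitInterval) : ℝ) := by
    rw [coe_criticalProbI]; exact criticalProb_zd_pos d hd1
  have hπ : ∀ m : ℕ, 0 < oneArmProb d (criticalProbI d) m := fun m => oneArmProb_pos hd1 _ hp m
  obtain ⟨n₀, c, C, hn₀, hc, hC, hA⟩ := exists_iicMeasure_real_pair_two_sided_criticalProbI hd hs hsL hϰ hA2 hl hcU hCU hUAD
  obtain ⟨n₂, c₂, C₂, hn₂, hc₂, hC₂, h2⟩ := exists_iicMeasure_real_openConn_two_sided_criticalProbI hd hs hsL hϰ hA2 hl hcU hCU hUAD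
  refine ⟨max n₀ n₂, c / C₂, C / c₂, le_trans hn₀ (le_max_left _ _), by positivity, by positivity,
    fun ν _ hν x y hx hxy hyx => ?_⟩
  have hx0 : n₀ ≤ Site.supNorm x := le_trans (le_max_left _ _) hx
  have hx2 : n₂ ≤ Site.supNorm x := le_trans (le_max_right _ _) hx
  have h := hA ν hν x y hx0 (hx0.trans hxy) (by rw [Site.supNorm_sub_comm]; exact le_trans (le_max_left _ _) hyx)
  rw [min_eq_left hxy, Site.supNorm_sub_comm x y] at h
  have ht := h2 ν hν (Site.supNorm x) x hx2 (self_mem_sphere x)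
  have hπa := hπ (Site.supNorm x)
  have hπe := hπ (Site.supNorm (y - x))
  have hν0 : 0 ≤ ν.real (openConn (0 : Site d) x) := measureReal_nonneg
  constructor
  · calc c / C₂ * oneArmProb d (criticalProbI d) (Site.supNorm (y - x)) * ν.real (openConn (0 : Site d) x)
        ≤ c / C₂ * oneArmProb d (criticalProbI d) (Site.supNorm (y - x)) * (C₂ * oneArmProb d (criticalProbI d) (Site.supNorm x)) :=
          mul_le_mul_of_nonneg_left ht.2 (mul_nonneg (by positivity) hπe.le)
      _ = c * oneArmProb d (criticalProbI d) (Site.supNorm x) * oneArmProb d (criticalProbI d) (Site.supNorm (y - x)) := by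
          field_simp
      _ ≤ _ := h.1
  · calc ν.real ((openConn (0 : Site d) x : Set (BondConfig (Site d))) ∩ openConn (0 : Site d) y)
        ≤ C * oneArmProb d (criticalProbI d) (Site.supNorm x) * oneArmProb d (criticalProbI d) (Site.supNorm (y - x)) := h.2
      _ = C / c₂ * oneArmProb d (criticalProbI d) (Site.supNorm (y - x)) * (c₂ * oneArmProb d (criticalProbI d) (Site.supNorm x)) := by
          field_simp
      _ ≤ C / c₂ * oneArmProb d (criticalProbI d) (Site.supNorm (y - x)) * ν.real (openConn (0 : Site d) x) :=
          mul_le_mul_of_nonneg_left ht.1 (mul_nonneg (by positivity) hπe.le)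

/-- **THE PAIR CORRELATION FUNCTION OF KESTEN'S IIC: `ν(x, y ∈ C(0)) / (ν(x ∈ C(0))·ν(y ∈ C(0))) ≍ π(‖x − y‖)/π(max(‖x‖,‖y‖))`**
(hypotheses of `exists_iicMeasure_real_pair_two_sided_criticalProbI`): there are `n₀ ≥ 1` and `0 < c, C` such that for every IIC
probability measure `ν` and all `x, y` with `‖x‖_∞, ‖y‖_∞, ‖x − y‖_∞ ≥ n₀`:
**`c·π(‖x − y‖)·ν(0 ↔ x)·ν(0 ↔ y) ≤ ν({0 ↔ x} ∩ {0 ↔ y})·π(max(‖x‖,‖y‖)) ≤ C·π(‖x − y‖)·ν(0 ↔ x)·ν(0 ↔ y)`** — the sites of the IIC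
cluster strongly at short range (`‖x − y‖ ≪ max(‖x‖,‖y‖)`) and decorrelate, up to constants, only at separations comparable to their
distance from the root (pair formula + two-point sandwich `ν(0 ↔ z) ≍ π(‖z‖)`). [cite: Kesten1986, Thm. (8)] [cite: BasuSapozhnikov2017ECP, Thm. 1.1] -/
theorem exists_iicMeasure_real_pair_correlation_two_sided_criticalProbI (hd : 2 ≤ d) {s L : ℕ} (hs : 2 ≤ s) (hsL : s ≤ L)
    {ϰ : ℝ} (hϰ : 0 < ϰ) (hA2 : SetToSetQuasiMultAspectAt d (criticalProbI d) s L ϰ) {l : ℕ} (hl : 2 ≤ l) {cU : ℝ} (hcU : 0 < cU)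
    (hCU : ∀ a : ℕ, 1 ≤ a → ∀ E : Set (BondConfig (Site d)), IsUpperSet E → MeasurableSet E →
      cU * (bondPercolation (zdGraph d) (criticalProbI d)).real E ≤ (bondPercolation (zdGraph d) (criticalProbI d)).real (E ∩
        {ω : BondConfig (Site d) | ∀ t ∈ innerBoundary (zdGraph d) (box d a), ∀ s ∈ innerBoundary (zdGraph d) (box d (l * a)),
          ∀ t' ∈ innerBoundary (zdGraph d) (box d a), ∀ s' ∈ innerBoundary (zdGraph d) (box d (l * a)),
          ω ∈ openConnIn (↑((box d (l * a) \ box d a) ∪ innerBoundary (zdGraph d) (box d a)) : Set (Site d)) t s →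
          ω ∈ openConnIn (↑((box d (l * a) \ box d a) ∪ innerBoundary (zdGraph d) (box d a)) : Set (Site d)) t' s' →
          ω ∈ openConnIn (↑((box d (l * a) \ box d a) ∪ innerBoundary (zdGraph d) (box d a)) : Set (Site d)) s s'}))
    (hUAD : ∀ ε : ℝ, 0 < ε → ∃ K₀ : ℕ, ∀ m : ℕ, 1 ≤ m → ∀ N : ℕ, K₀ * m ≤ N →
      (bondPercolation (zdGraph d) (criticalProbI d)).real (boxCrossing d m N) ≤ ε) :
    ∃ (n₀ : ℕ) (c C : ℝ), 1 ≤ n₀ ∧ 0 < c ∧ 0 < C ∧ ∀ (ν : Measure (BondConfig (Site d))) [IsProbabilityMeasure ν],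
      (∀ (F : Finset (Sym2 (Site d))) (E : Set (BondConfig (Site d))), MeasurableSet E → DeterminedBy E ↑F →
        Tendsto (fun n : ℕ => (bondPercolation (zdGraph d) (criticalProbI d)).real (E ∩ siteToBoundary d n) /
          oneArmProb d (criticalProbI d) n) atTop (𝓝 (ν.real E))) →
      ∀ x y : Site d, n₀ ≤ Site.supNorm x → n₀ ≤ Site.supNorm y → n₀ ≤ Site.supNorm (x - y) →
        c * oneArmProb d (criticalProbI d) (Site.supNorm (x - y)) * ν.real (openConn (0 : Site d) x) *
              ν.real (openConn (0 : Site d) y) ≤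
            ν.real ((openConn (0 : Site d) x : Set (BondConfig (Site d))) ∩ openConn (0 : Site d) y) *
              oneArmProb d (criticalProbI d) (max (Site.supNorm x) (Site.supNorm y)) ∧
          ν.real ((openConn (0 : Site d) x : Set (BondConfig (Site d))) ∩ openConn (0 : Site d) y) *
              oneArmProb d (criticalProbI d) (max (Site.supNorm x) (Site.supNorm y)) ≤
            C * oneArmProb d (criticalProbI d) (Site.supNorm (x - y)) * ν.real (openConn (0 : Site d) x) *
              ν.real (openConn (0 : Site d) y) := by
  have hd1 : 1 ≤ d := le_trans (by norm_num) hd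
  have hp : 0 < ((criticalProbI d : unitInterval) : ℝ) := by
    rw [coe_criticalProbI]; exact criticalProb_zd_pos d hd1
  have hπ : ∀ m : ℕ, 0 < oneArmProb d (criticalProbI d) m := fun m => oneArmProb_pos hd1 _ hp m
  obtain ⟨n₀, c, C, hn₀, hc, hC, hA⟩ := exists_iicMeasure_real_pair_two_sided_criticalProbI hd hs hsL hϰ hA2 hl hcU hCU hUAD
  obtain ⟨n₂, c₂, C₂, hn₂, hc₂, hC₂, h2⟩ := exists_iicMeasure_real_openConn_two_sided_criticalProbI hd hs hsL hϰ hA2 hl hcU hCU hUAD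
  refine ⟨max n₀ n₂, c / C₂ ^ 2, C / c₂ ^ 2, le_trans hn₀ (le_max_left _ _), by positivity, by positivity,
    fun ν _ hν x y hx hy hxy => ?_⟩
  wlog hab : Site.supNorm x ≤ Site.supNorm y generalizing x y
  · have h := this y x hy hx (by rwa [Site.supNorm_sub_comm]) (le_of_not_ge hab)
    rw [max_comm (Site.supNorm y) (Site.supNorm x), Site.supNorm_sub_comm, Set.inter_comm] at h
    have e1 : c / C₂ ^ 2 * oneArmProb d (criticalProbI d) (Site.supNorm (x - y)) * ν.real (openConn (0 : Site d) y) *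
        ν.real (openConn (0 : Site d) x) = c / C₂ ^ 2 * oneArmProb d (criticalProbI d) (Site.supNorm (x - y)) *
        ν.real (openConn (0 : Site d) x) * ν.real (openConn (0 : Site d) y) := by ring
    have e2 : C / c₂ ^ 2 * oneArmProb d (criticalProbI d) (Site.supNorm (x - y)) * ν.real (openConn (0 : Site d) y) *
        ν.real (openConn (0 : Site d) x) = C / c₂ ^ 2 * oneArmProb d (criticalProbI d) (Site.supNorm (x - y)) *
        ν.real (openConn (0 : Site d) x) * ν.real (openConn (0 : Site d) y) := by ring
    rw [e1, e2] at h
    exact h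
  have hx0 : n₀ ≤ Site.supNorm x := le_trans (le_max_left _ _) hx
  have hy0 : n₀ ≤ Site.supNorm y := le_trans (le_max_left _ _) hy
  have hxy0 : n₀ ≤ Site.supNorm (x - y) := le_trans (le_max_left _ _) hxy
  have h := hA ν hν x y hx0 hy0 hxy0
  rw [min_eq_left hab] at h
  rw [max_eq_right hab]
  have htx := h2 ν hν (Site.supNorm x) x (le_trans (le_max_right _ _) hx) (self_mem_sphere x)
  have hty := h2 ν hν (Site.supNorm y) y (le_trans (le_max_right _ _) hy) (self_mem_sphere y)
  have hπa := hπ (Site.supNorm x)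
  have hπb := hπ (Site.supNorm y)
  have hπe := hπ (Site.supNorm (x - y))
  have hνx : 0 ≤ ν.real (openConn (0 : Site d) x) := measureReal_nonneg
  have hνy : 0 ≤ ν.real (openConn (0 : Site d) y) := measureReal_nonneg
  have hνxy : 0 ≤ ν.real ((openConn (0 : Site d) x : Set (BondConfig (Site d))) ∩ openConn (0 : Site d) y) := measureReal_nonneg
  constructor
  · calc c / C₂ ^ 2 * oneArmProb d (criticalProbI d) (Site.supNorm (x - y)) * ν.real (openConn (0 : Site d) x) *
          ν.real (openConn (0 : Site d) y)
        ≤ c / C₂ ^ 2 * oneArmProb d (criticalProbI d) (Site.supNorm (x - y)) * (C₂ * oneArmProb d (criticalProbI d) (Site.supNorm x)) *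
          (C₂ * oneArmProb d (criticalProbI d) (Site.supNorm y)) :=
          mul_le_mul (mul_le_mul_of_nonneg_left htx.2 (mul_nonneg (by positivity) hπe.le)) hty.2 hνy
            (mul_nonneg (mul_nonneg (by positivity) hπe.le) (mul_nonneg hC₂.le hπa.le))
      _ = (c * oneArmProb d (criticalProbI d) (Site.supNorm x) * oneArmProb d (criticalProbI d) (Site.supNorm (x - y))) *
          oneArmProb d (criticalProbI d) (Site.supNorm y) := by field_simp
      _ ≤ _ := mul_le_mul_of_nonneg_right h.1 hπb.le
  · calc ν.real ((openConn (0 : Site d) x : Set (BondConfig (Site d))) ∩ openConn (0 : Site d) y) *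
          oneArmProb d (criticalProbI d) (Site.supNorm y)
        ≤ (C * oneArmProb d (criticalProbI d) (Site.supNorm x) * oneArmProb d (criticalProbI d) (Site.supNorm (x - y))) *
          oneArmProb d (criticalProbI d) (Site.supNorm y) := mul_le_mul_of_nonneg_right h.2 hπb.le
      _ = C / c₂ ^ 2 * oneArmProb d (criticalProbI d) (Site.supNorm (x - y)) * (c₂ * oneArmProb d (criticalProbI d) (Site.supNorm x)) *
          (c₂ * oneArmProb d (criticalProbI d) (Site.supNorm y)) := by field_simp
      _ ≤ C / c₂ ^ 2 * oneArmProb d (criticalProbI d) (Site.supNorm (x - y)) * ν.real (openConn (0 : Site d) x) *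
          ν.real (openConn (0 : Site d) y) :=
          mul_le_mul (mul_le_mul_of_nonneg_left htx.1 (mul_nonneg (by positivity) hπe.le)) hty.1 (mul_nonneg hc₂.le hπb.le)
            (mul_nonneg (mul_nonneg (by positivity) hπe.le) hνx)

/-- **THE SITES OF KESTEN'S IIC ARE QUASI-POSITIVELY CORRELATED: `ν(x, y ∈ C(0)) ≥ c·ν(x ∈ C(0))·ν(y ∈ C(0))`** (hypotheses of
`exists_iicMeasure_real_pair_two_sided_criticalProbI`): there are `n₀ ≥ 1` and `c > 0` such that for every IIC probability measure `ν` and all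
`x, y` with `‖x‖_∞, ‖y‖_∞, ‖x − y‖_∞ ≥ n₀`: **`c·ν(0 ↔ x)·ν(0 ↔ y) ≤ ν({0 ↔ x} ∩ {0 ↔ y})`**.  (The pair correlation function is
`≍ π(‖x − y‖)/π(max(‖x‖,‖y‖)) ≥ π(2max)/π(max) ≥ c` by the triangle inequality and the ratio bound.  Under `P_p` this would be Harris'
inequality; the IIC is a conditional limit, for which positive association is not automatic.) [cite: Kesten1986, Thm. (8)]
[cite: BasuSapozhnikov2017ECP, Thm. 1.1] -/
theorem exists_iicMeasure_real_pair_ge_mul_criticalProbI (hd : 2 ≤ d) {s L : ℕ} (hs : 2 ≤ s) (hsL : s ≤ L)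
    {ϰ : ℝ} (hϰ : 0 < ϰ) (hA2 : SetToSetQuasiMultAspectAt d (criticalProbI d) s L ϰ) {l : ℕ} (hl : 2 ≤ l) {cU : ℝ} (hcU : 0 < cU)
    (hCU : ∀ a : ℕ, 1 ≤ a → ∀ E : Set (BondConfig (Site d)), IsUpperSet E → MeasurableSet E →
      cU * (bondPercolation (zdGraph d) (criticalProbI d)).real E ≤ (bondPercolation (zdGraph d) (criticalProbI d)).real (E ∩
        {ω : BondConfig (Site d) | ∀ t ∈ innerBoundary (zdGraph d) (box d a), ∀ s ∈ innerBoundary (zdGraph d) (box d (l * a)),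
          ∀ t' ∈ innerBoundary (zdGraph d) (box d a), ∀ s' ∈ innerBoundary (zdGraph d) (box d (l * a)),
          ω ∈ openConnIn (↑((box d (l * a) \ box d a) ∪ innerBoundary (zdGraph d) (box d a)) : Set (Site d)) t s →
          ω ∈ openConnIn (↑((box d (l * a) \ box d a) ∪ innerBoundary (zdGraph d) (box d a)) : Set (Site d)) t' s' →
          ω ∈ openConnIn (↑((box d (l * a) \ box d a) ∪ innerBoundary (zdGraph d) (box d a)) : Set (Site d)) s s'}))
    (hUAD : ∀ ε : ℝ, 0 < ε → ∃ K₀ : ℕ, ∀ m : ℕ, 1 ≤ m → ∀ N : ℕ, K₀ * m ≤ N →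
      (bondPercolation (zdGraph d) (criticalProbI d)).real (boxCrossing d m N) ≤ ε) :
    ∃ (n₀ : ℕ) (c : ℝ), 1 ≤ n₀ ∧ 0 < c ∧ ∀ (ν : Measure (BondConfig (Site d))) [IsProbabilityMeasure ν],
      (∀ (F : Finset (Sym2 (Site d))) (E : Set (BondConfig (Site d))), MeasurableSet E → DeterminedBy E ↑F →
        Tendsto (fun n : ℕ => (bondPercolation (zdGraph d) (criticalProbI d)).real (E ∩ siteToBoundary d n) /
          oneArmProb d (criticalProbI d) n) atTop (𝓝 (ν.real E))) →
      ∀ x y : Site d, n₀ ≤ Site.supNorm x → n₀ ≤ Site.supNorm y → n₀ ≤ Site.supNorm (x - y) →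
        c * ν.real (openConn (0 : Site d) x) * ν.real (openConn (0 : Site d) y) ≤
          ν.real ((openConn (0 : Site d) x : Set (BondConfig (Site d))) ∩ openConn (0 : Site d) y) := by
  have hd1 : 1 ≤ d := le_trans (by norm_num) hd
  have hp : 0 < ((criticalProbI d : unitInterval) : ℝ) := by
    rw [coe_criticalProbI]; exact criticalProb_zd_pos d hd1
  have hπ : ∀ m : ℕ, 0 < oneArmProb d (criticalProbI d) m := fun m => oneArmProb_pos hd1 _ hp m
  obtain ⟨n₀, c, C, hn₀, hc, -, hA⟩ := exists_iicMeasure_real_pair_correlation_two_sided_criticalProbI hd hs hsL hϰ hA2 hl hcU hCU hUAD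
  obtain ⟨B, hB, hR⟩ := Rsw3.exists_oneArmProb_ratio_of_setToSetQuasiMultAspectAt hd hs hsL hϰ hA2
  refine ⟨n₀, c / B, hn₀, by positivity, fun ν _ hν x y hx hy hxy => ?_⟩
  wlog hab : Site.supNorm x ≤ Site.supNorm y generalizing x y
  · have h := this y x hy hx (by rwa [Site.supNorm_sub_comm]) (le_of_not_ge hab)
    rw [Set.inter_comm] at h
    calc c / B * ν.real (openConn (0 : Site d) x) * ν.real (openConn (0 : Site d) y)
        = c / B * ν.real (openConn (0 : Site d) y) * ν.real (openConn (0 : Site d) x) := by ring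
      _ ≤ _ := h
  have h := (hA ν hν x y hx hy hxy).1
  rw [max_eq_right hab] at h
  have hπb := hπ (Site.supNorm y)
  have hπe := hπ (Site.supNorm (x - y))
  have hνx : 0 ≤ ν.real (openConn (0 : Site d) x) := measureReal_nonneg
  have hνy : 0 ≤ ν.real (openConn (0 : Site d) y) := measureReal_nonneg
  -- `‖x − y‖ ≤ 2‖y‖`, so `π(‖y‖) ≤ B·π(‖x − y‖)`... unless `‖x − y‖ ≤ ‖y‖`, where monotonicity suffices
  have heab : Site.supNorm (x - y) ≤ Site.supNorm x + Site.supNorm y := by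
    rw [sub_eq_add_neg, ← Site.supNorm_neg y]; exact Site.supNorm_add_le x (-y)
  have hB1 : 1 ≤ B := by
    have h := hR 1 1 le_rfl le_rfl (by norm_num)
    have h1 := hπ 1
    by_contra hlt
    have h2 : B * oneArmProb d (criticalProbI d) 1 < 1 * oneArmProb d (criticalProbI d) 1 :=
      mul_lt_mul_of_pos_right (lt_of_not_ge hlt) h1
    linarith
  have hratio : oneArmProb d (criticalProbI d) (Site.supNorm y) ≤ B * oneArmProb d (criticalProbI d) (Site.supNorm (x - y)) := by
    rcases le_or_gt (Site.supNorm (x - y)) (Site.supNorm y) with h1 | h1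
    · calc oneArmProb d (criticalProbI d) (Site.supNorm y) ≤ oneArmProb d (criticalProbI d) (Site.supNorm (x - y)) :=
            real_siteToBoundary_antitone _ h1
        _ = 1 * oneArmProb d (criticalProbI d) (Site.supNorm (x - y)) := (one_mul _).symm
        _ ≤ B * oneArmProb d (criticalProbI d) (Site.supNorm (x - y)) := mul_le_mul_of_nonneg_right hB1 hπe.le
    · exact hR _ _ (le_trans hn₀ hy) h1.le (by omega)
  -- `(c/B)·ν(x)ν(y)·π(‖y‖) ≤ c·π(‖x−y‖)·ν(x)ν(y) ≤ ν(x,y)·π(‖y‖)`, then cancel `π(‖y‖) > 0`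
  have key : c / B * ν.real (openConn (0 : Site d) x) * ν.real (openConn (0 : Site d) y) * oneArmProb d (criticalProbI d) (Site.supNorm y) ≤
      ν.real ((openConn (0 : Site d) x : Set (BondConfig (Site d))) ∩ openConn (0 : Site d) y) *
        oneArmProb d (criticalProbI d) (Site.supNorm y) :=
    calc c / B * ν.real (openConn (0 : Site d) x) * ν.real (openConn (0 : Site d) y) * oneArmProb d (criticalProbI d) (Site.supNorm y)
        ≤ c / B * ν.real (openConn (0 : Site d) x) * ν.real (openConn (0 : Site d) y) *
            (B * oneArmProb d (criticalProbI d) (Site.supNorm (x - y))) :=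
          mul_le_mul_of_nonneg_left hratio (mul_nonneg (mul_nonneg (by positivity) hνx) hνy)
      _ = c * oneArmProb d (criticalProbI d) (Site.supNorm (x - y)) * ν.real (openConn (0 : Site d) x) *
            ν.real (openConn (0 : Site d) y) := by field_simp
      _ ≤ _ := h
  exact le_of_mul_le_mul_right key hπb

end Summit.CriticalPhenomena.PercolationContinuityZ3.Theorems.Crossing

end
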